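import Mathlib
import HarnessLib
import Summits.Ventures.LatticeQCDFlow.Exactness.SphereFamilyLeapfrog
import Summits.Ventures.LatticeQCDFlow.Exactness.MomentumRefresh
import Summits.Ventures.LatticeQCDFlow.Exactness.StdGaussianRadial

/-!
# Leapfrog HMC on a finite family of spheres of mixed dimensions (`cpn_2d.HMCCPN`'s phase space): the configuration kernel and its exactness

HONEST FRAMING: exact (Metropolis-corrected) sampling algorithms for lattice gauge theory;
figures of merit are autocorrelation/cost numbers at stated couplings and volumes; no
continuum-physics claim.

Venture `LatticeQCDFlow` (cell pub-lqcd), topic `Exactness`, FANOUT row 9 (eng-latcore, the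
engine `latflow.core.cpn_2d.HMCCPN.trajectory(τ, nstep)`).  NEW WORK of the cell over Mathlib and
the tree: part 1a `SphereFamilyLeapfrog.lean` (`famProposal F δ n`: `n` leapfrog steps — coupled
half kicks, sitewise exact geodesic drifts — then the flip; an involution preserving
`(⊗ uniformSphere) ⊗ (⊗ Lebesgue)`), row 7's `MomentumRefresh.lean` (`refreshUpdate`,
**`hmc_config_exact`**), `RefreshScan.lean` (`invariant_smul`), row 7's `SphereHMCExact.lean`
(`gaussianWeight_univ_ne_zero_ne_top`, the one-sphere Gaussian mass) and `StdGaussianRadial.lean`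
(`lintegral_prod_pi`).  Nothing is cited as a fact.  Printed counterparts, NAMED ONLY:
Duane–Kennedy–Pendleton–Roweth 1987; Engel–Schaefer, Comput. Phys. Commun. 182 (2011) 2107, §2.2.

## Content (`ι` finite, `k : ι → ℕ`, `FamS k i = S^{k i+1} ⊂ FamE k i = ℝ^{k i+2}`)

* `famKinetic p = Σᵢ ‖pᵢ‖²/2` (the engine's `|π|²/2 + ω²/2`, ambient form; continuous, even,
  `≤ |ι|R²/2` on the box `‖pᵢ‖ ≤ R`), `famMomentumWeight = e^{−T}·⊗dpᵢ`, `famMomentumLaw = Z⁻¹·…`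
  with **`famMomentumWeight_univ_ne_zero_ne_top`** (`Z = ∏ᵢ Zᵢ`, Tonelli; each factor by row 7's
  one-sphere lemma) — a probability law;
* **`famLeapfrogHMC F δ n hF S`** — THE CONFIGURATION KERNEL, literally
  `refreshUpdate (involMH (famProposal F δ n) _ (S + T)) (famMomentumLaw k)`: refresh ambient
  Gaussian momenta, `n` leapfrog steps with the coupled force `F`, flip, Metropolis on `H = S + T`,
  forget the momenta; Markov (`isMarkovKernel_famLeapfrogHMC`);
* **`famLeapfrogHMC_invariant`** — EXACTNESS: `e^{−S} · ⊗ uniformSphere` is invariant for every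
  measurable action `S`, measurable force field `F`, step `δ`, length `n`; `famGibbsLaw S =
  Z_S⁻¹ e^{−S} · ⊗ uniformSphere`, `famLeapfrogHMC_invariant_gibbsLaw`.

NOT CLAIMED here: ergodicity (parts 2–4, at `n = 1` only); that the engine's force is the projected
gradient of the action (irrelevant to exactness); the value of `Z`; floating point.
-/

noncomputable section

namespace Summit.Ventures.LatticeQCDFlow.Exactness

open MeasureTheory Measure Metric Set Real ProbabilityTheory
open scoped ENNReal InnerProductSpace

section Family

variable {ι : Type*} [Fintype ι] {k : ι → ℕ}

/-! ## §2 The Gaussian momenta, the kernel, exactness -/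

/-- The kinetic energy `T(p) = Σᵢ ‖pᵢ‖²/2` (the engine's `|π|²/2 + ω²/2`, ambient form). -/
def famKinetic (p : Π i, FamE k i) : ℝ := ∑ i, ‖p i‖ ^ 2 / 2

/-- The kinetic energy is continuous. -/
theorem continuous_famKinetic : Continuous (famKinetic (k := k)) :=
  continuous_finsetSum _ fun i _ => (((continuous_apply i).norm).pow 2).div_const 2

/-- The kinetic energy is measurable. -/
theorem measurable_famKinetic : Measurable (famKinetic (k := k)) :=
  continuous_famKinetic.measurable

/-- The kinetic energy is non-negative. -/
theorem famKinetic_nonneg (p : Π i, FamE k i) : 0 ≤ famKinetic p :=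
  Finset.sum_nonneg fun _ _ => div_nonneg (sq_nonneg _) zero_le_two

/-- The kinetic energy is even. -/
theorem famKinetic_neg (p : Π i, FamE k i) : famKinetic (-p) = famKinetic p := by
  simp [famKinetic]

/-- In a box `‖pᵢ‖ ≤ R` the kinetic energy is at most `|ι| R²/2`. -/
theorem famKinetic_le_of_norm_le {R : ℝ} {p : Π i, FamE k i} (hp : ∀ i, ‖p i‖ ≤ R) :
    famKinetic p ≤ Fintype.card ι * R ^ 2 / 2 := by
  unfold famKinetic
  calc ∑ i, ‖p i‖ ^ 2 / 2 ≤ ∑ _i : ι, R ^ 2 / 2 :=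
        Finset.sum_le_sum fun i _ =>
          div_le_div_of_nonneg_right (pow_le_pow_left₀ (norm_nonneg _) (hp i) 2) zero_le_two
    _ = Fintype.card ι * R ^ 2 / 2 := by
        rw [Finset.sum_const, Finset.card_univ, nsmul_eq_mul, mul_div_assoc]

/-- **The un-normalised momentum weight** `e^{−T(p)} ⊗dpᵢ`. -/
def famMomentumWeight (k : ι → ℕ) : Measure (Π i, FamE k i) :=
  (Measure.pi fun i => (volume : Measure (FamE k i))).withDensity
    fun p => ENNReal.ofReal (Real.exp (-famKinetic p))

/-- **The momentum refresh law** `Z⁻¹ e^{−T(p)} ⊗dpᵢ` (independent standard Gaussians). -/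
def famMomentumLaw (k : ι → ℕ) : Measure (Π i, FamE k i) :=
  (famMomentumWeight k univ)⁻¹ • famMomentumWeight k

/-- **`Z = ∏ᵢ Zᵢ` is neither zero nor infinite** (Tonelli over the indices; each one-sphere
Gaussian mass by `SphereHMCExact.gaussianWeight_univ_ne_zero_ne_top`). -/
theorem famMomentumWeight_univ_ne_zero_ne_top :
    famMomentumWeight k univ ≠ 0 ∧ famMomentumWeight k univ ≠ ⊤ := by
  have hmeas1 : ∀ i, Measurable fun q : FamE k i => ENNReal.ofReal (Real.exp (-(‖q‖ ^ 2 / 2))) :=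
    fun i => (Real.measurable_exp.comp (measurable_norm.pow_const 2 |>.div_const 2).neg).ennreal_ofReal
  have h1 : ∀ p : Π i, FamE k i, ENNReal.ofReal (Real.exp (-famKinetic p)) =
      ∏ i, ENNReal.ofReal (Real.exp (-(‖p i‖ ^ 2 / 2))) := by
    intro p
    rw [← ENNReal.ofReal_prod_of_nonneg (fun i _ => (Real.exp_pos _).le), ← Real.exp_sum,
      Finset.sum_neg_distrib]
    rfl
  have hZi : ∀ i, (∫⁻ q : FamE k i, ENNReal.ofReal (Real.exp (-(‖q‖ ^ 2 / 2)))) ≠ 0 ∧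
      (∫⁻ q : FamE k i, ENNReal.ofReal (Real.exp (-(‖q‖ ^ 2 / 2)))) ≠ ⊤ := by
    intro i
    have h := gaussianWeight_univ_ne_zero_ne_top (m := Fin (k i + 2))
    rwa [withDensity_apply _ MeasurableSet.univ, Measure.restrict_univ] at h
  rw [famMomentumWeight, withDensity_apply _ MeasurableSet.univ, Measure.restrict_univ]
  simp_rw [h1]
  rw [lintegral_prod_pi (fun i => (volume : Measure (FamE k i))) hmeas1]
  exact ⟨Finset.prod_ne_zero_iff.2 fun i _ => (hZi i).1, ENNReal.prod_ne_top fun i _ => (hZi i).2⟩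

/-- The momentum refresh law is a probability law. -/
instance isProbabilityMeasure_famMomentumLaw : IsProbabilityMeasure (famMomentumLaw k) :=
  ⟨by rw [famMomentumLaw, Measure.smul_apply, smul_eq_mul,
    ENNReal.inv_mul_cancel famMomentumWeight_univ_ne_zero_ne_top.1
      famMomentumWeight_univ_ne_zero_ne_top.2]⟩

/-- **THE CONFIGURATION KERNEL of leapfrog HMC on the family of spheres** (the engine's
`HMCCPN.trajectory(τ, nstep)` with `δ = τ/nstep`, for the CP(N−1) dimension family): refresh the
momenta from `famMomentumLaw`, run `n` leapfrog steps with the coupled force `F`, flip, accept with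
`min(1, e^{−ΔH})`, `H = S(x) + T(p)`, forget the momenta — literally the tree's
`refreshUpdate (involMH Ψ _ H) μP`. -/
def famLeapfrogHMC (F : (Π i, FamS k i) → (Π i, FamE k i)) (δ : ℝ) (n : ℕ) (hF : Measurable F)
    (S : (Π i, FamS k i) → ℝ) : Kernel (Π i, FamS k i) (Π i, FamS k i) :=
  refreshUpdate
    (involMH ⇑(famProposal F δ n) (measurable_famProposal hF δ n)
      fun z : (Π i, FamS k i) × (Π i, FamE k i) => S z.1 + famKinetic z.2)
    (famMomentumLaw k)

/-- **The Gibbs law** `Z_S⁻¹ e^{−S} · ⊗ uniformSphere`. -/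
def famGibbsLaw (S : (Π i, FamS k i) → ℝ) : Measure (Π i, FamS k i) :=
  (((Measure.pi fun i => uniformSphere (volume : Measure (FamE k i))).withDensity
      fun x => ENNReal.ofReal (Real.exp (-S x))) univ)⁻¹ •
    (Measure.pi fun i => uniformSphere (volume : Measure (FamE k i))).withDensity
      fun x => ENNReal.ofReal (Real.exp (-S x))

/-- **EXACTNESS: leapfrog HMC on the family of spheres leaves `e^{−S} · ⊗ uniformSphere` invariant**
— every measurable action `S`, measurable force field `F`, step `δ`, length `n`
(`MomentumRefresh.hmc_config_exact` with Liouville and the involution above). -/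
theorem famLeapfrogHMC_invariant {F : (Π i, FamS k i) → (Π i, FamE k i)} (hF : Measurable F) (δ : ℝ)
    (n : ℕ) {S : (Π i, FamS k i) → ℝ} (hS : Measurable S) :
    Kernel.Invariant (famLeapfrogHMC F δ n hF S)
      ((Measure.pi fun i => uniformSphere (volume : Measure (FamE k i))).withDensity
        fun x => ENNReal.ofReal (Real.exp (-S x))) := by
  unfold famLeapfrogHMC famMomentumLaw famMomentumWeight
  exact hmc_config_exact hS measurable_famKinetic (involutive_famProposal F δ n)
    (measurePreserving_famProposal hF δ n) famMomentumWeight_univ_ne_zero_ne_top.1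
    famMomentumWeight_univ_ne_zero_ne_top.2

/-- … hence it leaves the normalised Gibbs law invariant. -/
theorem famLeapfrogHMC_invariant_gibbsLaw {F : (Π i, FamS k i) → (Π i, FamE k i)} (hF : Measurable F)
    (δ : ℝ) (n : ℕ) {S : (Π i, FamS k i) → ℝ} (hS : Measurable S) :
    Kernel.Invariant (famLeapfrogHMC F δ n hF S) (famGibbsLaw S) :=
  invariant_smul (famLeapfrogHMC_invariant hF δ n hS) _

/-- The kernel is Markov. -/
instance isMarkovKernel_famLeapfrogHMC {F : (Π i, FamS k i) → (Π i, FamE k i)} (hF : Measurable F)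
    (δ : ℝ) (n : ℕ) (S : (Π i, FamS k i) → ℝ) [Fact (Measurable S)] :
    IsMarkovKernel (famLeapfrogHMC F δ n hF S) := by
  haveI : Fact (Measurable fun z : (Π i, FamS k i) × (Π i, FamE k i) => S z.1 + famKinetic z.2) :=
    ⟨((Fact.out : Measurable S).comp measurable_fst).add (measurable_famKinetic.comp measurable_snd)⟩
  unfold famLeapfrogHMC; infer_instance

end Family

end Summit.Ventures.LatticeQCDFlow.Exactness

end
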